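import Mathlib
import HarnessLib

/-!
# Adhikari–Cao (2022/2025): exponential decay of correlations for finite lattice gauge theories at weak coupling

Statement-level transcription (named facts + hypothesis-free definitions; no proofs of the
analysis) of the main theorem of

* A. Adhikari, S. Cao, *Correlation decay for finite lattice gauge theories at weak coupling*,
  Ann. Probab. **53** (2025) 140–174, arXiv:2202.10375 (v3 = accepted version). [AdhikariCao2025]

**Source used.** The arXiv id `2202.10375` was confirmed (`lit search`; v1 2022-02-21, v3 2024-03-17
"Accepted version. To appear in AOP"). All loci below (`§`, `Thm`, `(eq)`) are those of arXiv v3,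
whose LaTeX source was read directly: `\numberwithin{theorem}{section}`, so the main theorem
(label `thm:main-general`, the only theorem of §1) is **Theorem 1.1**; the definitions are §1.2
"Definitions and Notation", equations (1.1)–(1.3).

**What the paper sets up (§1.2, verbatim up to notation).** `G` a FINITE group ("possibly
non-Abelian"), `ρ` a unitary representation of `G` of dimension `d`, `χ = Tr ρ`. A finite lattice
`Λ := ([a₁,b₁] × ⋯ × [a₄,b₄]) ∩ ℤ⁴` with all `b_i − a_i` equal (a cube; free boundary conditions;
dimension four only). `Λ₀` = vertices, `Λ₁` = positively oriented nearest-neighbour edges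
(`e = (x, x + e_i)`), `Λ₂` = plaquettes (unit squares whose four boundary edges are in `Λ`). Edge
configurations `σ ∈ G^{Λ₁}`, extended to reversed edges by `σ_{(y,x)} := σ_{(x,y)}⁻¹`. For a
plaquette with vertices `x₁,x₂,x₃,x₄` in counter-clockwise order
`σ_p := σ_{(x₁,x₂)} σ_{(x₂,x₃)} σ_{(x₃,x₄)} σ_{(x₄,x₁)}` (1.1);
`S_Λ(σ) := Σ_{p ∈ Λ₂} Re(χ(1) − χ(σ_p))` (1.2);
`μ_{Λ,β}(σ) := Z_{Λ,β}⁻¹ e^{−β S_Λ(σ)}` (1.3), a probability measure on the finite set `G^{Λ₁}`.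
Holonomy `σ_γ := σ_{e₁} ⋯ σ_{e_n}` of a closed loop `γ = e₁ … e_n` (oriented edges);
`Δ_G := min_{g ≠ 1} Re(χ(1) − χ(g))`; `f : G^k → ℂ` is *conjugacy invariant* if
`f(h₁⁻¹g₁h₁, …, h_k⁻¹g_kh_k) = f(g₁, …, g_k)`; a *rectangle* `B ⊆ Λ` is
`[x₁,y₁] × ⋯ × [x₄,y₄]` (`x_i = y_i` allowed) and `|B|` is the number of plaquettes contained in
`B`.

**Theorem 1.1 (as printed).** Let `β ≥ (1/Δ_G)(114 + 4 log |G|)`. Let `L ≥ 0`. Let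
`B₁, B₂ ⊆ Λ` be rectangles at `ℓ^∞` distance at least `L` from each other (the `ℓ^∞` distance
between any vertex of `B₁` and any vertex of `B₂` is `≥ L`). Let `k₁, k₂ ≥ 1` and let
`f₁ : G^{k₁} → ℂ`, `f₂ : G^{k₂} → ℂ` be conjugacy invariant. For `i = 1,2` let
`γ₁^{(i)}, …, γ_{k_i}^{(i)}` be closed loops contained in `B_i`. Let `Σ ∼ μ_{Λ,β}`. Then
`|Cov(f₁(Σ_{γ₁^{(1)}}, …, Σ_{γ_{k₁}^{(1)}}), f₂(Σ_{γ₁^{(2)}}, …, Σ_{γ_{k₂}^{(2)}}))|`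
`≤ 4 (4·10²⁴ |G|²)^{|B₁|+|B₂|} ‖f₁‖_∞ ‖f₂‖_∞ e^{−(β/2) Δ_G (L−1)}`.
(Remark 1.2: e.g. Wilson loop observables, or arbitrary functions of arbitrarily many Wilson loop
observables.) Here `Cov(X,Y) = E[XY] − E[X]E[Y]` for complex random variables (the bilinear
covariance used in the proof of Lemma 3.2), `log` is the natural logarithm (proof of Prop. 6.1:
the hypothesis is used as `4·10²⁴|G|² e^{−(β/2)Δ_G} ≤ 1`).

**Readings declared (transcriber's, each flagged at the declaration).**
(R1) The cube is parametrised by its lower corner `a ∈ ℤ⁴` and common side length `s ∈ ℕ`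
(`b_i = a_i + s`). (R2) A closed loop is a finite cyclic sequence of `n ≥ 1` oriented lattice
edges, consecutive edges sharing endpoints cyclically (`ClosedLoop`, indexed by `Fin n`, closure via
`finRotate`); "contained in `B`" = every edge has both endpoints in `B` (then it is an edge of `Λ`
since `B ⊆ Λ` is a box). (R3) The printed threshold `β ≥ (1/Δ_G)(114 + 4 log|G|)` presupposes
`Δ_G > 0` (i.e. `Re χ(g) < χ(1)` for `g ≠ 1`, equivalently `ρ` faithful); it is typed in the
product form `114 + 4 log|G| ≤ Δ_G · β`, which is equivalent when `Δ_G > 0` and is (correctly)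
unsatisfiable when `Δ_G = 0` — no `1/0`. For the trivial group the infimum defining `Δ_G` is over
an empty family and takes Mathlib's junk value `0`, again making the hypothesis unsatisfiable.
(R4) `‖f‖_∞ = sup_{g ∈ G^k} |f(g)|` (a maximum over a finite set). (R5) The `ℓ^∞` distance of
lattice points is the sup norm of the difference in `ℝ⁴`; `L` is a real number `≥ 0`.
(R6) Unitarity of `ρ` is kept as an explicit hypothesis (`IsUnitaryRep`) exactly as printed,
although the statement depends on `ρ` only through its character.

**Not transcribed (deliberately).** Lemma 3.2 (abstract swapping-map ⇒ covariance bound),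
Prop. 3.3 / Cor. 5.x / Prop. 6.1 (existence of the swapping map on `Hom(π₁(S₁(Λ),x₀), G)²` and
the bound `P((Ψ₁,Ψ₂) ∉ E(B₁,B₂)) ≤ 2(4·10²⁴|G|²)^{|B₁|+|B₂|} e^{−(β/2)Δ_G(L−1)}`) — internal to
the proof; Appendix B Thm. B.1 and Appendix C Thm. C.1 (lattice Higgs models at large / small `κ`:
"for sufficiently large `β` and `κ` … `Cov(f,g) ≤ C‖f‖_∞‖g‖_∞ |G|^{8L}|H/H_t|^{8L} [e^{−𝔠κ/6}]^{L−|B₁∪B₂|}`"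
with `C`, `𝔠` not explicit) — constants not printed as numbers, so not typed here. The bib entry's
note field renders the threshold as "(114 + 4|G|)"; the accepted version prints `4 log |G|`
(the held plain-text rendering drops `\log` and `\Re`).

Nothing in this file is a claim about continuum Yang–Mills or about compact (Lie) gauge groups:
`G` is finite throughout, as in the source.
-/

noncomputable section

open Finset Matrix

namespace Literature.MathematicalPhysics.QuantumFieldTheory.AdhikariCao2022

/-! ### §1.2 — the lattice, edges, plaquettes -/

/-- A lattice site of `ℤ⁴` (the paper works in dimension four only, §1.2). [cite: AdhikariCao2025, §1.2] -/
abbrev Site : Type := Fin 4 → ℤ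

/-- The coordinate unit vector `e_i ∈ ℤ⁴`. [cite: AdhikariCao2025, §1.2] -/
def unitVec (i : Fin 4) : Site := Pi.single i 1

/-- The finite lattice `Λ := ([a₁,b₁] × ⋯ × [a₄,b₄]) ∩ ℤ⁴` "where `b_i − a_i` is the same for all
`i ∈ [4]`", parametrised (reading R1) by the lower corner `a = lower` and the common side length
`s = side`, `b_i = a_i + s`. [cite: AdhikariCao2025, §1.2] -/
structure Cube where
  /-- the lower corner `(a₁, …, a₄)` -/
  lower : Site
  /-- the common side length `b_i − a_i` -/
  side : ℕ

namespace Cube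

/-- `Λ₀`: the vertex set `{x ∈ ℤ⁴ : a_i ≤ x_i ≤ a_i + s}` of the cube. [cite: AdhikariCao2025, §1.2] -/
def vertices (Λ : Cube) : Finset Site :=
  Fintype.piFinset fun i => Finset.Icc (Λ.lower i) (Λ.lower i + Λ.side)

/-- `Λ₁`: the positively oriented nearest-neighbour edges of `Λ`, an edge `e = (x, x + e_i)` being
recorded as the pair `(x, i)`; both endpoints lie in `Λ₀`. [cite: AdhikariCao2025, §1.2] -/
def edges (Λ : Cube) : Finset (Site × Fin 4) :=
  (Λ.vertices ×ˢ (Finset.univ : Finset (Fin 4))).filter fun e => e.1 + unitVec e.2 ∈ Λ.vertices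

/-- `Λ₂`: the plaquettes of `Λ` ("a unit square whose four boundary edges are in `Λ`"), a plaquette
being recorded as `(x, i, j)` with `i < j`: the unit square with corners `x`, `x + e_i`,
`x + e_i + e_j`, `x + e_j`, all four required to be vertices of `Λ` (for a box this is the same as
its four edges being edges of `Λ`). [cite: AdhikariCao2025, §1.2] -/
def plaquettes (Λ : Cube) : Finset (Site × Fin 4 × Fin 4) :=
  (Λ.vertices ×ˢ (Finset.univ : Finset (Fin 4)) ×ˢ (Finset.univ : Finset (Fin 4))).filter fun p =>
    p.2.1 < p.2.2 ∧ p.1 + unitVec p.2.1 ∈ Λ.vertices ∧ p.1 + unitVec p.2.2 ∈ Λ.vertices ∧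
      p.1 + unitVec p.2.1 + unitVec p.2.2 ∈ Λ.vertices

end Cube

/-! ### §1.2 — edge configurations, holonomies, the measure `μ_{Λ,β}` -/

/-- The (finite) space `G^{Λ₁}` of edge configurations: an assignment of a group element to every
positively oriented edge of `Λ`. [cite: AdhikariCao2025, §1.2] -/
abbrev EdgeConfig (Λ : Cube) (G : Type*) : Type _ := Λ.edges → G

variable {Λ : Cube} {G : Type*} [Group G]

/-- The value `σ_{(x, x+e_i)}` of an edge configuration on the positively oriented edge `(x, i)`,
extended by the junk value `1` to pairs `(x, i)` that are not edges of `Λ` (only edges of `Λ` are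
ever evaluated in the statements below). [cite: AdhikariCao2025, §1.2] -/
def edgeVal (σ : EdgeConfig Λ G) (x : Site) (i : Fin 4) : G :=
  if h : (x, i) ∈ Λ.edges then σ ⟨(x, i), h⟩ else 1

/-- An oriented lattice edge: the positively oriented edge `(x, x + e_i)` (`pos = true`) or its
reversal `(x + e_i, x)` (`pos = false`); "we can naturally extend `σ` to the negatively oriented
version of `e` by setting `σ_{(y,x)} := σ_e⁻¹`". [cite: AdhikariCao2025, §1.2] -/
structure OrientedEdge where
  /-- lower endpoint `x` of the underlying positively oriented edge `(x, x + e_i)` -/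
  base : Site
  /-- direction `i` -/
  dir : Fin 4
  /-- orientation: `true` = traversed from `x` to `x + e_i` -/
  pos : Bool

namespace OrientedEdge

/-- Initial vertex of an oriented edge. [cite: AdhikariCao2025, §1.2] -/
def source (e : OrientedEdge) : Site := if e.pos then e.base else e.base + unitVec e.dir

/-- Final vertex of an oriented edge. [cite: AdhikariCao2025, §1.2] -/
def target (e : OrientedEdge) : Site := if e.pos then e.base + unitVec e.dir else e.base

end OrientedEdge

/-- `σ_e` for an oriented edge: `σ_{(x,x+e_i)}`, resp. its inverse for the reversed edge.
[cite: AdhikariCao2025, §1.2] -/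
def orientedEdgeVal (σ : EdgeConfig Λ G) (e : OrientedEdge) : G :=
  if e.pos then edgeVal σ e.base e.dir else (edgeVal σ e.base e.dir)⁻¹

/-- A closed loop `γ = e₁ … e_n` "denoted by its sequence of oriented edges" (reading R2): `n ≥ 1`
oriented edges indexed cyclically by `Fin n`, the final vertex of `e_k` being the initial vertex of
`e_{k+1}` (indices mod `n`, via `finRotate`). `|γ| = n` is its length. [cite: AdhikariCao2025, §1.2] -/
structure ClosedLoop where
  /-- the length `|γ| = n` -/
  len : ℕ
  /-- the oriented edges `e₁, …, e_n` -/
  edge : Fin len → OrientedEdge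
  /-- a loop has at least one edge -/
  len_pos : 0 < len
  /-- consecutive edges (cyclically) share endpoints -/
  linked : ∀ k : Fin len, (edge k).target = (edge (finRotate len k)).source

namespace ClosedLoop

/-- A closed loop is *contained in* a vertex set `V` (e.g. the vertices of a rectangle `B`, or of
`Λ`) when every one of its edges has both endpoints in `V` (reading R2). [cite: AdhikariCao2025, §1.2 and Thm. 1.1 ("closed loops contained in `B_i`")] -/
def ContainedIn (γ : ClosedLoop) (V : Finset Site) : Prop :=
  ∀ k : Fin γ.len, (γ.edge k).source ∈ V ∧ (γ.edge k).target ∈ V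

end ClosedLoop

/-- The holonomy `σ_γ := σ_{e₁} ⋯ σ_{e_n}` of `σ` around the closed loop `γ = e₁ … e_n` (ordered
product). [cite: AdhikariCao2025, §1.2] -/
def holonomy (σ : EdgeConfig Λ G) (γ : ClosedLoop) : G :=
  (List.ofFn fun k : Fin γ.len => orientedEdgeVal σ (γ.edge k)).prod

/-- The plaquette variable (1.1) `σ_p := σ_{(x₁,x₂)} σ_{(x₂,x₃)} σ_{(x₃,x₄)} σ_{(x₄,x₁)}` for the
plaquette `p = (x, i, j)` with corners `x₁ = x`, `x₂ = x + e_i`, `x₃ = x + e_i + e_j`, `x₄ = x + e_j`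
in counter-clockwise order ("by the conjugacy invariance of `χ`, it does not matter which vertex of
`p` we choose to start at"). [cite: AdhikariCao2025, §1.2 eq. (1.1)] -/
def plaqHolonomy (σ : EdgeConfig Λ G) (p : Site × Fin 4 × Fin 4) : G :=
  edgeVal σ p.1 p.2.1 * edgeVal σ (p.1 + unitVec p.2.1) p.2.2 *
    (edgeVal σ (p.1 + unitVec p.2.2) p.2.1)⁻¹ * (edgeVal σ p.1 p.2.2)⁻¹

/-- The character `χ = Tr ρ` of a (matrix) representation `ρ` of dimension `d`. [cite: AdhikariCao2025, §1.2] -/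
def character {d : ℕ} (ρ : G →* Matrix (Fin d) (Fin d) ℂ) : G → ℂ := fun g => (ρ g).trace

/-- "`ρ` is a unitary representation of `G`, with dimension `d`": every `ρ(g)` is a unitary matrix
(reading R6: kept as an explicit hypothesis, as printed). [cite: AdhikariCao2025, §1.2] -/
def IsUnitaryRep {d : ℕ} (ρ : G →* Matrix (Fin d) (Fin d) ℂ) : Prop :=
  ∀ g : G, ρ g ∈ Matrix.unitaryGroup (Fin d) ℂ

/-- The Wilson action (1.2) `S_Λ(σ) := Σ_{p ∈ Λ₂} Re(χ(1) − χ(σ_p))`. [cite: AdhikariCao2025, §1.2 eq. (1.2)] -/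
def action {d : ℕ} (ρ : G →* Matrix (Fin d) (Fin d) ℂ) (σ : EdgeConfig Λ G) : ℝ :=
  ∑ p ∈ Λ.plaquettes, (character ρ 1 - character ρ (plaqHolonomy σ p)).re

variable [Fintype G]

/-- The Boltzmann weight `e^{−β S_Λ(σ)}`. [cite: AdhikariCao2025, §1.2 eq. (1.3)] -/
def weight {d : ℕ} (ρ : G →* Matrix (Fin d) (Fin d) ℂ) (β : ℝ) (σ : EdgeConfig Λ G) : ℝ :=
  Real.exp (-β * action ρ σ)

/-- The normalising constant `Z_{Λ,β} = Σ_{σ ∈ G^{Λ₁}} e^{−β S_Λ(σ)}` (finite sum: `G` and `Λ₁`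
are finite). [cite: AdhikariCao2025, §1.2 eq. (1.3)] -/
def partitionFn {d : ℕ} (ρ : G →* Matrix (Fin d) (Fin d) ℂ) (β : ℝ) (Λ : Cube) : ℝ :=
  ∑ σ : EdgeConfig Λ G, weight ρ β σ

/-- The lattice gauge theory (1.3) `μ_{Λ,β}(σ) := Z_{Λ,β}⁻¹ e^{−β S_Λ(σ)}`, "the lattice gauge theory
with gauge group `G`, on `Λ`, with inverse coupling constant `β`", as a probability mass function on
the finite set `G^{Λ₁}`. [cite: AdhikariCao2025, §1.2 eq. (1.3)] -/
def gibbsProb {d : ℕ} (ρ : G →* Matrix (Fin d) (Fin d) ℂ) (β : ℝ) (σ : EdgeConfig Λ G) : ℝ :=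
  weight ρ β σ / partitionFn ρ β Λ

/-- Expectation `E[F(Σ)]`, `Σ ∼ μ_{Λ,β}`, of a complex observable `F` on `G^{Λ₁}` (a finite
average). [cite: AdhikariCao2025, §1.2] -/
def expect {d : ℕ} (ρ : G →* Matrix (Fin d) (Fin d) ℂ) (β : ℝ) (F : EdgeConfig Λ G → ℂ) : ℂ :=
  ∑ σ : EdgeConfig Λ G, (gibbsProb ρ β σ : ℂ) * F σ

/-- The covariance `Cov(F₁(Σ), F₂(Σ)) = E[F₁F₂] − E[F₁]E[F₂]`, `Σ ∼ μ_{Λ,β}`, of two complex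
observables (bilinear, no complex conjugation — the form used in the proof of Lemma 3.2).
[cite: AdhikariCao2025, Thm. 1.1 and proof of Lemma 3.2] -/
def cov {d : ℕ} (ρ : G →* Matrix (Fin d) (Fin d) ℂ) (β : ℝ) (F₁ F₂ : EdgeConfig Λ G → ℂ) : ℂ :=
  expect ρ β (fun σ => F₁ σ * F₂ σ) - expect ρ β F₁ * expect ρ β F₂

omit [Fintype G] in
/-- `Δ_G := min_{g ∈ G, g ≠ 1} Re(χ(1) − χ(g))` (for a finite group the infimum over the finite
family is a minimum; for the trivial group the family is empty and the value is Mathlib's junk `0`,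
reading R3). [cite: AdhikariCao2025, §1.2] -/
def deltaG {d : ℕ} (ρ : G →* Matrix (Fin d) (Fin d) ℂ) : ℝ :=
  ⨅ g : {g : G // g ≠ 1}, (character ρ 1 - character ρ (g : G)).re

/-! ### Theorem 1.1 — conjugacy-invariant functions, rectangles, the statement -/

omit [Fintype G] in
/-- "`f : G^k → ℂ` is conjugacy invariant if, for any `g₁, …, g_k ∈ G` and `h₁, …, h_k ∈ G`,
`f(h₁⁻¹ g₁ h₁, …, h_k⁻¹ g_k h_k) = f(g₁, …, g_k)`" (independent conjugations in each slot).
[cite: AdhikariCao2025, §1.2] -/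
def IsConjInvariant {k : ℕ} (f : (Fin k → G) → ℂ) : Prop :=
  ∀ g h : Fin k → G, f (fun i => (h i)⁻¹ * g i * h i) = f g

omit [Group G] [Fintype G] in
/-- `‖f‖_∞ = sup_{g ∈ G^k} |f(g)|` (reading R4; a maximum, `G^k` being finite and non-empty).
[cite: AdhikariCao2025, Thm. 1.1] -/
def supNorm {k : ℕ} (f : (Fin k → G) → ℂ) : ℝ :=
  ⨆ g : Fin k → G, ‖f g‖

/-- A rectangle `[x₁,y₁] × ⋯ × [x₄,y₄]` of `ℤ⁴` ("where we allow `x_i = y_i`"), given by its two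
corners `lo = (x_i)`, `hi = (y_i)`; that it is non-degenerate (`lo ≤ hi`) and contained in `Λ` are
hypotheses of the theorem, as printed. [cite: AdhikariCao2025, §1.2] -/
structure Rectangle where
  /-- the corner `(x₁, …, x₄)` -/
  lo : Site
  /-- the corner `(y₁, …, y₄)` -/
  hi : Site

namespace Rectangle

/-- The vertex set `{z ∈ ℤ⁴ : x_i ≤ z_i ≤ y_i}` of a rectangle. [cite: AdhikariCao2025, §1.2] -/
def vertices (B : Rectangle) : Finset Site :=
  Fintype.piFinset fun i => Finset.Icc (B.lo i) (B.hi i)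

/-- `|B|`: "the number of plaquettes contained in `B`" — unit squares `(x, i, j)`, `i < j`, all four
of whose corners are vertices of `B`. [cite: AdhikariCao2025, §1.2] -/
def plaqCount (B : Rectangle) : ℕ :=
  ((B.vertices ×ˢ (Finset.univ : Finset (Fin 4)) ×ˢ (Finset.univ : Finset (Fin 4))).filter fun p =>
    p.2.1 < p.2.2 ∧ p.1 + unitVec p.2.1 ∈ B.vertices ∧ p.1 + unitVec p.2.2 ∈ B.vertices ∧
      p.1 + unitVec p.2.1 + unitVec p.2.2 ∈ B.vertices).card

end Rectangle

omit [Group G] [Fintype G] in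
/-- The `ℓ^∞` distance `max_i |x_i − y_i|` between two lattice sites (reading R5: the sup norm of
the difference, computed in `ℝ⁴`). [cite: AdhikariCao2025, Thm. 1.1] -/
def linfDist (x y : Site) : ℝ := ‖fun i : Fin 4 => ((x i - y i : ℤ) : ℝ)‖

/-- **Adhikari–Cao, Theorem 1.1 (exponential decay of correlations for finite lattice gauge theories
at weak coupling; `d = 4`, cube with free boundary conditions, Wilson action of a unitary
representation `ρ` with character `χ`).** Let `G` be a finite group and `ρ` a unitary representation
of `G` of dimension `d`; let `Λ` be a cube as in §1.2. Let `β ≥ (1/Δ_G)(114 + 4 log |G|)` (typed as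
`114 + 4 log|G| ≤ Δ_G β`, reading R3). Let `L ≥ 0`. Let `B₁, B₂ ⊆ Λ` be rectangles such that the
`ℓ^∞` distance between any vertex of `B₁` and any vertex of `B₂` is at least `L`. Let `k₁, k₂ ≥ 1`
and let `f₁ : G^{k₁} → ℂ`, `f₂ : G^{k₂} → ℂ` be conjugacy invariant. For `i = 1, 2` let
`γ₁^{(i)}, …, γ_{k_i}^{(i)}` be closed loops contained in `B_i`, and `Σ ∼ μ_{Λ,β}`. Then
`|Cov(f₁(Σ_{γ₁^{(1)}}, …, Σ_{γ_{k₁}^{(1)}}), f₂(Σ_{γ₁^{(2)}}, …, Σ_{γ_{k₂}^{(2)}}))|`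
`≤ 4 · (4·10²⁴ |G|²)^{|B₁| + |B₂|} · ‖f₁‖_∞ ‖f₂‖_∞ · e^{−(β/2) Δ_G (L − 1)}`.
(Remark 1.2: this covers Wilson loop observables `W_{γ,χ₀} = χ₀(σ_γ)` and arbitrary functions of
arbitrarily many of them.) Named fact, not proved here. [cite: AdhikariCao2025, Thm. 1.1] -/
def correlationDecay : Prop :=
  ∀ (G : Type) [Group G] [Fintype G] (d : ℕ) (ρ : G →* Matrix (Fin d) (Fin d) ℂ), IsUnitaryRep ρ →
  ∀ (Λ : Cube) (β : ℝ), 114 + 4 * Real.log (Fintype.card G) ≤ deltaG ρ * β →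
  ∀ (L : ℝ), 0 ≤ L →
  ∀ (B₁ B₂ : Rectangle), B₁.lo ≤ B₁.hi → B₂.lo ≤ B₂.hi →
    B₁.vertices ⊆ Λ.vertices → B₂.vertices ⊆ Λ.vertices →
    (∀ x ∈ B₁.vertices, ∀ y ∈ B₂.vertices, L ≤ linfDist x y) →
  ∀ (k₁ k₂ : ℕ), 1 ≤ k₁ → 1 ≤ k₂ →
  ∀ (f₁ : (Fin k₁ → G) → ℂ) (f₂ : (Fin k₂ → G) → ℂ), IsConjInvariant f₁ → IsConjInvariant f₂ →
  ∀ (γ₁ : Fin k₁ → ClosedLoop) (γ₂ : Fin k₂ → ClosedLoop),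
    (∀ j, (γ₁ j).ContainedIn B₁.vertices) → (∀ j, (γ₂ j).ContainedIn B₂.vertices) →
    ‖cov (Λ := Λ) ρ β (fun σ => f₁ fun j => holonomy σ (γ₁ j))
        (fun σ => f₂ fun j => holonomy σ (γ₂ j))‖ ≤
      4 * (4 * 10 ^ 24 * (Fintype.card G : ℝ) ^ 2) ^ (B₁.plaqCount + B₂.plaqCount) *
        supNorm f₁ * supNorm f₂ * Real.exp (-(β / 2) * deltaG ρ * (L - 1))

end Literature.MathematicalPhysics.QuantumFieldTheory.AdhikariCao2022

end
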